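/-
Copyright: h21 programme. STAGED THEOREMS PORT (val-idea-28 g5): Part X (module-side torus closure; graded + strongly connected ⇒ `IrreducibleInv`) of the
crux workfile `Cruxes/DualUnipotentThreeHalves/InitialForm.lean` rev 15 @d4fa72b6089b, on top of the Theorems port of Part I
(`…LongMassLedgerTorusInitial.lean`, val-port-3 g3).  Decl texts verbatim; namespaces `…Theorems.GrenetZeon.InitialForm.{GradedModule,GradedIrreducible}`.
-/
import Summits.ValiantsHypothesis.ValiantsHypothesis.Theorems.GrenetZeonDualUnipotentThreeHalvesLongMassLedgerTorusInitial
import Summits.ValiantsHypothesis.ValiantsHypothesis.Theorems.GrenetZeonDualUnipotentThreeHalvesHeavyTopThreeFour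

/-!
# Graded families with strongly connected support are `IrreducibleInv` (instrument; by name vs ✓ `SlowCore.IrreducibleInv`)

Provenance: verbatim port of Part X of `Cruxes/DualUnipotentThreeHalves/InitialForm.lean` rev 14 (val-idea-28 g5; crit-7 V42 «r10 in kernel — CORRECT»;
idea-27 g8 MEMO §1 row r10).  HONEST STATUS: VP ≠ VNP is NOT proved; crux 24318 and (c) are OPEN; this file is NOT progress on (c) — by ✓ `inv_iff_all`
irreducibility is free in (c); the use of this file is the census side (which graded candidate pencils are irreducible species).  `--supports
stmt-ValiantsHypothesis-24318 --as helper`.  (`…HeavyTopThreeFour` is imported only for the twin ✓ `RadicalSplit.linPencil_map_eval`.)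

CONTENTS: `GradedModule.Homogeneous`, `initSub_mulVec_mem`, ★ `exists_graded_invariant` (the initial subspace of an invariant subspace of a family of
homogeneous operators is invariant, weight-graded, of the same finrank), `single_mem_of_graded`, ★ `bot_or_top_of_stronglyConnected`; by name
`GradedIrreducible.mulVec_mem_of_mem_span`, ★ `irreducibleInv_of_graded_stronglyConnected`, ★ `irreducibleInv_linPencil_of_graded_stronglyConnected`, the converse `not_irreducibleInv_linPencil_of_closed`
and the exact test ★ `irreducibleInv_linPencil_iff_stronglyConnected` (rev 15).
-/

set_option linter.dupNamespace false

noncomputable section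

/-! # PART X — Torus closure on the MODULE side (rev 14): invariant subspaces of HOMOGENEOUS operator families; strongly connected ⇒ irreducible

(idea-27 g8 row r10 / crit-7 V38 (B), by name vs `SlowCore.IrreducibleInv`.)  The torus `diag(τ^{h_i})` on `ℂ^ι` conjugates a matrix `G` with
`G i j ≠ 0 → h i + a = h j + c` (HOMOGENEOUS of degree `c − a ∈ ℤ`) to a scalar multiple of itself, so the set of `G`-invariant subspaces is torus-stable
and the torus limit of an invariant subspace — its INITIAL SUBSPACE `initSub h V` (Part I) — is again invariant, weight-graded, of the same dimension
(`exists_graded_invariant`; no topology: a direct check on initial forms, valid for degrees of either sign).  With SIMPLE weights a graded subspace is a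
coordinate subspace, so a family with STRONGLY CONNECTED joint support digraph (`i → j` iff some `G j i ≠ 0`) has no common invariant subspace other than
`⊥`, `⊤` (`bot_or_top_of_stronglyConnected`), and BY NAME `GradedIrreducible.irreducibleInv_of_graded_stronglyConnected : … → IrreducibleInv B` for an
affine pencil and any homogeneous family `𝓜 ⊆ span{B(x)}` (e.g. `B(0)` and the linear coefficient matrices) with strongly connected support.
Honest scope: instruments; nothing here bears on the truth of (c); 24318 OPEN; VP ≠ VNP NOT proved.
-/

namespace Summit.ValiantsHypothesis.ValiantsHypothesis.Theorems.GrenetZeon.InitialForm.GradedModule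

open Matrix

variable {ι : Type*} [Fintype ι] [DecidableEq ι]

/-- `G` is HOMOGENEOUS for the weights `h` (of degree `c − a ∈ ℤ`): `G i j ≠ 0 → h i + a = h j + c`; i.e. `diag(τ^h) G diag(τ^h)⁻¹ = τ^{c−a} G`.
[this file; predicate, not a research statement] -/
def Homogeneous (h : ι → ℕ) (G : Matrix ι ι ℂ) : Prop := ∃ a c : ℕ, ∀ i j, G i j ≠ 0 → h i + a = h j + c

omit [DecidableEq ι] in
/-- Entrywise `mulVec` (definitional). [folklore] -/
theorem mulVec_apply' (G : Matrix ι ι ℂ) (v : ι → ℂ) (i : ι) : (G *ᵥ v) i = ∑ j, G i j * v j := rfl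

omit [DecidableEq ι] in
/-- The initial subspace of a `G`-invariant subspace is `G`-invariant, for `G` homogeneous (either sign of the degree). -/
theorem initSub_mulVec_mem (h : ι → ℕ) (K : Submodule ℂ (ι → ℂ)) (G : Matrix ι ι ℂ) (hG : Homogeneous h G)
    (hGK : ∀ v ∈ K, G *ᵥ v ∈ K) {s : ι → ℂ} (hs : s ∈ initSub h K) : G *ᵥ s ∈ initSub h K := by
  classical
  obtain ⟨a, c, hac⟩ := hG
  obtain ⟨t, htK, hsupp, hse⟩ := hs
  refine ⟨fun d => if c ≤ d + a then G *ᵥ t (d + a - c) else 0, fun d => ?_, fun d i hi => ?_, fun i => ?_⟩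
  · by_cases hd : c ≤ d + a
    · simp only [hd, if_true]; exact hGK _ (htK _)
    · simp only [hd, if_false]; exact K.zero_mem
  · by_cases hd : c ≤ d + a
    · simp only [hd, if_true, mulVec_apply']
      refine Finset.sum_eq_zero fun j _ => ?_
      by_cases hGij : G i j = 0
      · rw [hGij, zero_mul]
      · have hj : h j < d + a - c := by have := hac i j hGij; omega
        rw [hsupp (d + a - c) j hj, mul_zero]
    · simp only [hd, if_false, Pi.zero_apply]
  · by_cases hd : c ≤ h i + a
    · simp only [hd, if_true, mulVec_apply']
      refine Finset.sum_congr rfl fun j _ => ?_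
      by_cases hGij : G i j = 0
      · rw [hGij, zero_mul, zero_mul]
      · rw [hse j, show h j = h i + a - c by have := hac i j hGij; omega]
    · simp only [hd, if_false, Pi.zero_apply, mulVec_apply']
      refine Finset.sum_eq_zero fun j _ => ?_
      by_cases hGij : G i j = 0
      · rw [hGij, zero_mul]
      · exact absurd (hac i j hGij) (by omega)

omit [DecidableEq ι] in
/-- ★ **MODULE-SIDE TORUS CLOSURE.**  An invariant subspace of a family of HOMOGENEOUS operators may be replaced by a WEIGHT-GRADED invariant subspace of the
same dimension (its initial subspace along the torus). -/
theorem exists_graded_invariant (h : ι → ℕ) (𝓜 : Set (Matrix ι ι ℂ)) (hhom : ∀ G ∈ 𝓜, Homogeneous h G)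
    (V : Submodule ℂ (ι → ℂ)) (hV : ∀ G ∈ 𝓜, ∀ v ∈ V, G *ᵥ v ∈ V) :
    ∃ V₀ : Submodule ℂ (ι → ℂ), Module.finrank ℂ V₀ = Module.finrank ℂ V ∧ (∀ s ∈ V₀, ∀ c, wtProj h c s ∈ V₀) ∧
      ∀ G ∈ 𝓜, ∀ v ∈ V₀, G *ᵥ v ∈ V₀ :=
  ⟨initSub h V, finrank_initSub h V, fun _ hs c => wtProj_mem_initSub hs c,
    fun G hG _ hv => initSub_mulVec_mem h V G (hhom G hG) (hV G hG) hv⟩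

omit [Fintype ι] in
/-- With SIMPLE weights (`h` injective) a graded subspace contains the coordinate components of its vectors. -/
theorem single_mem_of_graded {h : ι → ℕ} (hh : Function.Injective h) {V : Submodule ℂ (ι → ℂ)}
    (hgr : ∀ s ∈ V, ∀ c, wtProj h c s ∈ V) {s : ι → ℂ} (hs : s ∈ V) (i : ι) : Pi.single i (s i) ∈ V := by
  have : wtProj h (h i) s = Pi.single i (s i) := by
    funext j
    by_cases hji : j = i
    · subst hji; simp [wtProj]
    · have hne : h j ≠ h i := fun heq => hji (hh heq)
      simp [wtProj, hne, hji]
  rw [← this]; exact hgr s hs (h i)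

omit [Fintype ι] in
/-- A subspace containing a nonzero multiple of `Pi.single i` contains `Pi.single i 1`. [folklore] -/
theorem single_one_mem_of_single_mem {V : Submodule ℂ (ι → ℂ)} {i : ι} {x : ℂ} (hx : x ≠ 0) (h : Pi.single i x ∈ V) :
    (Pi.single i (1 : ℂ) : ι → ℂ) ∈ V := by
  have e : (Pi.single i (1 : ℂ) : ι → ℂ) = x⁻¹ • (Pi.single i x : ι → ℂ) := by
    funext k
    by_cases hk : k = i
    · subst hk; simp [inv_mul_cancel₀ hx]
    · simp [hk]
  rw [e]; exact V.smul_mem _ h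

/-- ★ **STRONGLY CONNECTED SUPPORT ⇒ IRREDUCIBLE.**  A family of operators homogeneous for SIMPLE weights whose joint support digraph (`i → j` iff some
`G j i ≠ 0`) is strongly connected — no nonempty proper vertex set is closed under out-edges — has no common invariant subspace other than `⊥` and `⊤`. -/
theorem bot_or_top_of_stronglyConnected {h : ι → ℕ} (hh : Function.Injective h) (𝓜 : Set (Matrix ι ι ℂ))
    (hhom : ∀ G ∈ 𝓜, Homogeneous h G)
    (hconn : ∀ I : Set ι, I.Nonempty → I ≠ Set.univ → ∃ G ∈ 𝓜, ∃ i ∈ I, ∃ j ∉ I, G j i ≠ 0)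
    (V : Submodule ℂ (ι → ℂ)) (hV : ∀ G ∈ 𝓜, ∀ v ∈ V, G *ᵥ v ∈ V) : V = ⊥ ∨ V = ⊤ := by
  classical
  obtain ⟨V₀, hdim, hgr, hinv⟩ := exists_graded_invariant h 𝓜 hhom V hV
  set I : Set ι := {i | (Pi.single i (1 : ℂ) : ι → ℂ) ∈ V₀} with hI
  have hclosed : ∀ G ∈ 𝓜, ∀ i ∈ I, ∀ j, G j i ≠ 0 → j ∈ I := by
    intro G hG i hi j hji
    have h1 : G *ᵥ (Pi.single i (1 : ℂ)) ∈ V₀ := hinv G hG _ hi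
    have h2 := single_mem_of_graded hh hgr h1 j
    have h3 : (G *ᵥ (Pi.single i (1 : ℂ) : ι → ℂ)) j = G j i := by
      simp [mulVec_apply', Pi.single_apply]
    rw [h3] at h2
    exact single_one_mem_of_single_mem hji h2
  rcases Set.eq_empty_or_nonempty I with hIe | hIne
  · left
    have hV0 : V₀ = ⊥ := by
      rw [Submodule.eq_bot_iff]
      intro s hs
      funext i
      by_contra hsi
      have hmem : i ∈ I := single_one_mem_of_single_mem hsi (single_mem_of_graded hh hgr hs i)
      rw [hIe] at hmem
      exact hmem
    rw [hV0, finrank_bot] at hdim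
    exact Submodule.finrank_eq_zero.mp hdim.symm
  · by_cases hIu : I = Set.univ
    · right
      have hV0 : V₀ = ⊤ := by
        rw [eq_top_iff, ← (Pi.basisFun ℂ ι).span_eq, Submodule.span_le]
        rintro _ ⟨i, rfl⟩
        have hi : i ∈ I := hIu ▸ Set.mem_univ i
        rw [Pi.basisFun_apply]
        exact hi
      rw [hV0, finrank_top] at hdim
      exact Submodule.eq_top_of_finrank_eq hdim.symm
    · exfalso
      obtain ⟨G, hG, i, hi, j, hj, hji⟩ := hconn I hIne hIu
      exact hj (hclosed G hG i hi j hji)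

end Summit.ValiantsHypothesis.ValiantsHypothesis.Theorems.GrenetZeon.InitialForm.GradedModule

namespace Summit.ValiantsHypothesis.ValiantsHypothesis.Theorems.GrenetZeon.InitialForm.GradedIrreducible

open Matrix
open Summit.ValiantsHypothesis.ValiantsHypothesis.Cruxes.TwoDimCoefficients.DimTwoCases (AffMat IsAffine)
open Summit.ValiantsHypothesis.ValiantsHypothesis.Theorems.GrenetZeon.SlowCore (IrreducibleInv)
open Summit.ValiantsHypothesis.ValiantsHypothesis.Theorems.GrenetZeon.RadicalSplit (linPencil linPencil_map_eval)
open Summit.ValiantsHypothesis.ValiantsHypothesis.Theorems.GrenetZeon.InitialForm.GradedModule (Homogeneous bot_or_top_of_stronglyConnected)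

variable {n b : ℕ}

/-- Invariance under every point `B(x)` of the pencil gives invariance under their span. -/
theorem mulVec_mem_of_mem_span (B : AffMat n b) (V : Submodule ℂ (Fin b → ℂ))
    (hV : ∀ x : Fin n × Fin n → ℂ, ∀ w ∈ V, (B.map (MvPolynomial.eval x)) *ᵥ w ∈ V)
    {G : Matrix (Fin b) (Fin b) ℂ} (hG : G ∈ Submodule.span ℂ (Set.range fun x : Fin n × Fin n → ℂ => B.map (MvPolynomial.eval x)))
    {v : Fin b → ℂ} (hv : v ∈ V) : G *ᵥ v ∈ V := by
  induction hG using Submodule.span_induction with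
  | mem G hG => obtain ⟨x, rfl⟩ := hG; exact hV x v hv
  | zero => rw [Matrix.zero_mulVec]; exact V.zero_mem
  | add G G' _ _ h1 h2 => rw [Matrix.add_mulVec]; exact V.add_mem h1 h2
  | smul a G _ h1 => rw [Matrix.smul_mulVec]; exact V.smul_mem a h1

/-- ★ **BY NAME (`SlowCore.IrreducibleInv`): GRADED + STRONGLY CONNECTED ⇒ `IrreducibleInv`.**  If some family `𝓜` of matrices in the span of the points
`B(x)` of an affine pencil (e.g. `B(0)` and the linear coefficient matrices `B(E_e) − B(0)`) consists of operators HOMOGENEOUS for SIMPLE weights `h` on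
`Fin b` and has STRONGLY CONNECTED joint support, then `B` has no common invariant subspace: `IrreducibleInv B`.  (idea-27 g8 r10 — module-side torus
closure, Part I `initSub`; no Burnside, no topology.) -/
theorem irreducibleInv_of_graded_stronglyConnected (B : AffMat n b) (h : Fin b → ℕ) (hh : Function.Injective h)
    (𝓜 : Set (Matrix (Fin b) (Fin b) ℂ))
    (h𝓜 : 𝓜 ⊆ Submodule.span ℂ (Set.range fun x : Fin n × Fin n → ℂ => B.map (MvPolynomial.eval x)))
    (hhom : ∀ G ∈ 𝓜, Homogeneous h G)
    (hconn : ∀ I : Set (Fin b), I.Nonempty → I ≠ Set.univ → ∃ G ∈ 𝓜, ∃ i ∈ I, ∃ j ∉ I, G j i ≠ 0) :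
    IrreducibleInv B := fun V hV =>
  bot_or_top_of_stronglyConnected hh 𝓜 hhom hconn V fun _ hG _ hv => mulVec_mem_of_mem_span B V hV (h𝓜 hG) hv


/-- ★ **LINEAR GRADED PENCILS** (the shape of idea-27 g8's «SCC pencils of a torus-fixed `P₀` with simple weights»): if every coefficient matrix `M e` of
the linear pencil `P₀(x) = Σ_e x_e · M e` is homogeneous for SIMPLE weights `h` and the joint support digraph of the `M e` is strongly connected, then
`IrreducibleInv (linPencil M)`. -/
theorem irreducibleInv_linPencil_of_graded_stronglyConnected (M : Fin n × Fin n → Matrix (Fin b) (Fin b) ℂ) (h : Fin b → ℕ)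
    (hh : Function.Injective h) (hhom : ∀ e, Homogeneous h (M e))
    (hconn : ∀ I : Set (Fin b), I.Nonempty → I ≠ Set.univ → ∃ e, ∃ i ∈ I, ∃ j ∉ I, M e j i ≠ 0) :
    IrreducibleInv (linPencil M) := by
  refine irreducibleInv_of_graded_stronglyConnected (linPencil M) h hh (Set.range M) ?_ ?_ ?_
  · rintro _ ⟨e, rfl⟩
    refine Submodule.subset_span ⟨Pi.single e 1, ?_⟩
    simp only [linPencil_map_eval, Pi.single_apply, ite_smul, one_smul, zero_smul, Finset.sum_ite_eq', Finset.mem_univ, if_true]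
  · rintro _ ⟨e, rfl⟩; exact hhom e
  · intro I hI hIu
    obtain ⟨e, i, hi, j, hj, hne⟩ := hconn I hI hIu
    exact ⟨M e, ⟨e, rfl⟩, i, hi, j, hj, hne⟩

/-! ### The converse (no grading needed) and the EXACT irreducibility test for graded linear pencils -/

/-- The coordinate subspace on a vertex set `I`. -/
def coordSub (I : Set (Fin b)) : Submodule ℂ (Fin b → ℂ) :=
  Submodule.span ℂ ((fun i => (Pi.single i (1 : ℂ) : Fin b → ℂ)) '' I)

/-- Vectors of the coordinate subspace of `I` vanish off `I`. [folklore] -/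
theorem apply_eq_zero_of_mem_coordSub {I : Set (Fin b)} {v : Fin b → ℂ} (hv : v ∈ coordSub I) {j : Fin b} (hj : j ∉ I) :
    v j = 0 := by
  induction hv using Submodule.span_induction with
  | mem v hv =>
    obtain ⟨i, hi, rfl⟩ := hv
    have hji : j ≠ i := fun h => hj (h ▸ hi)
    simp [hji]
  | zero => rfl
  | add v w _ _ h1 h2 => simp [h1, h2]
  | smul a v _ h1 => simp [h1]

/-- A matrix with no edge leaving `I` (`G j i = 0` for `i ∈ I`, `j ∉ I`) preserves the coordinate subspace on `I`. -/
theorem mulVec_mem_coordSub {I : Set (Fin b)} (G : Matrix (Fin b) (Fin b) ℂ) (hG : ∀ i ∈ I, ∀ j ∉ I, G j i = 0)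
    {v : Fin b → ℂ} (hv : v ∈ coordSub I) : G *ᵥ v ∈ coordSub I := by
  induction hv using Submodule.span_induction with
  | mem v hv =>
    obtain ⟨i, hi, rfl⟩ := hv
    have hcol : G *ᵥ (Pi.single i (1 : ℂ) : Fin b → ℂ) = ∑ j, G j i • (Pi.single j (1 : ℂ) : Fin b → ℂ) := by
      funext k
      simp [Matrix.mulVec, dotProduct, Pi.single_apply, Finset.sum_apply]
    rw [hcol]
    refine Submodule.sum_mem _ fun j _ => ?_
    by_cases hj : j ∈ I
    · exact Submodule.smul_mem _ _ (Submodule.subset_span ⟨j, hj, rfl⟩)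
    · rw [hG i hi j hj, zero_smul]; exact Submodule.zero_mem _
  | zero => rw [Matrix.mulVec_zero]; exact Submodule.zero_mem _
  | add v w _ _ h1 h2 => rw [Matrix.mulVec_add]; exact Submodule.add_mem _ h1 h2
  | smul a v _ h1 => rw [Matrix.mulVec_smul]; exact Submodule.smul_mem _ _ h1

/-- The converse direction needs NO grading: a nonempty proper vertex set closed under the joint support digraph of the coefficient matrices spans a
common invariant coordinate subspace, so the linear pencil is NOT `IrreducibleInv`. -/
theorem not_irreducibleInv_linPencil_of_closed (M : Fin n × Fin n → Matrix (Fin b) (Fin b) ℂ) (I : Set (Fin b)) (hI : I.Nonempty)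
    (hIu : I ≠ Set.univ) (hclosed : ∀ e, ∀ i ∈ I, ∀ j ∉ I, M e j i = 0) : ¬ IrreducibleInv (linPencil M) := by
  intro hirr
  have hinv : ∀ x : Fin n × Fin n → ℂ, ∀ w ∈ coordSub I, ((linPencil M).map (MvPolynomial.eval x)) *ᵥ w ∈ coordSub I := by
    intro x w hw
    rw [linPencil_map_eval, Matrix.sum_mulVec]
    refine Submodule.sum_mem _ fun e _ => ?_
    rw [Matrix.smul_mulVec]
    exact Submodule.smul_mem _ _ (mulVec_mem_coordSub (M e) (hclosed e) hw)
  rcases hirr (coordSub I) hinv with h | h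
  · obtain ⟨i, hi⟩ := hI
    have hmem : (Pi.single i (1 : ℂ) : Fin b → ℂ) ∈ coordSub I := Submodule.subset_span ⟨i, hi, rfl⟩
    rw [h, Submodule.mem_bot] at hmem
    have := congrFun hmem i
    simp at this
  · obtain ⟨j, hj⟩ : ∃ j, j ∉ I := by
      by_contra hall
      push Not at hall
      exact hIu (Set.eq_univ_of_forall hall)
    have hmem : (Pi.single j (1 : ℂ) : Fin b → ℂ) ∈ coordSub I := by rw [h]; exact Submodule.mem_top
    have := apply_eq_zero_of_mem_coordSub hmem hj
    simp at this

/-- ★ **EXACT IRREDUCIBILITY TEST** for linear pencils graded by SIMPLE weights: `IrreducibleInv (linPencil M)` iff the joint support digraph of the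
coefficient matrices is strongly connected (no nonempty proper vertex set closed under out-edges).  The census-side instrument: which graded candidate
pencils are irreducible species is a finite combinatorial check. -/
theorem irreducibleInv_linPencil_iff_stronglyConnected (M : Fin n × Fin n → Matrix (Fin b) (Fin b) ℂ) (h : Fin b → ℕ)
    (hh : Function.Injective h) (hhom : ∀ e, Homogeneous h (M e)) :
    IrreducibleInv (linPencil M) ↔ ∀ I : Set (Fin b), I.Nonempty → I ≠ Set.univ → ∃ e, ∃ i ∈ I, ∃ j ∉ I, M e j i ≠ 0 := by
  refine ⟨fun hirr I hI hIu => ?_, irreducibleInv_linPencil_of_graded_stronglyConnected M h hh hhom⟩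
  by_contra hno
  push Not at hno
  exact not_irreducibleInv_linPencil_of_closed M I hI hIu hno hirr

end Summit.ValiantsHypothesis.ValiantsHypothesis.Theorems.GrenetZeon.InitialForm.GradedIrreducible

end
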